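import Mathlib.RingTheory.SimpleModule.Isotypic
import Mathlib.Algebra.Module.Submodule.EqLocus
import Mathlib.RingTheory.NonUnitalSubsemiring.Basic
import HarnessLib

/-!
# A central idempotent acts on every isotypic component as `1` or as `0`

Topic `RingTheory/SimpleModule`; namespace `Literature.RingTheory.SimpleModule`.  THEOREMS ONLY (no definition, no named fact, no
instance, no `sorry`); pure Mathlib (`RingTheory/SimpleModule/Isotypic`: `isotypicComponent`, `isotypicComponents`; Schur's lemma
`LinearMap.bijective_or_eq_zero`; `LinearMap.eqLocus`).

## Mathematics (Wedderburn bookkeeping, [Lam, *A First Course in Noncommutative Rings*, §3; Bourbaki, *Algèbre* VIII §3 no. 2, §4 no. 4/no. 6, §5 no. 1])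

Let `R` be a ring, `M` an `R`-module and `e ∈ R` a CENTRAL IDEMPOTENT (`e² = e`, `e r = r e` for all `r`).  Multiplication by `e` is then
an `R`-LINEAR idempotent endomorphism `e_M` of `M` (`smulEnd_apply`) preserving every submodule.  On a SIMPLE submodule `m`, Schur's lemma
makes `e_M|_m` zero or bijective, and a bijective idempotent is the identity: so `e` acts on `m` as `1` or as `0`
(`smul_eq_self_or_eq_zero_of_isSimpleModule`).  The alternative is transported along `R`-linear isomorphisms, hence is CONSTANT on an
isotypic component `c = Σ_{m ≅ S} m`: `e` acts on `c` as `1` or as `0` (`smul_eq_self_or_eq_zero_of_mem_isotypicComponents`), i.e.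
`c ≤ eqLocus e_M id` or `c ≤ ker e_M`.  This is the generic half of «central idempotents of a semisimple algebra ↔ unions of isotypic
types»; which types occur is the representation-theoretic input of the consumer.

DICTIONARY LINE (cell `hodgecm-mathlib`, crux `HLiu418` = stmt-HodgeConjecture-24832, d6 HOME card, DEF request DH2): `R :=` the
level-`K` Hecke algebra image (semisimple by ★ `RingTheory/CentralSimple/PositiveInvolutionStableSubalgebra` §4 under the Rosati
involution), `M := H¹` at level `K`, `e := ε_lab` the central idempotent of the Galois orbit of the label: `ε_lab` is `1` exactly on the
isotypic components of the simple constituents in that orbit and `0` on the others — the «`ε_lab`-image = `ω⋆_lab`-isotypic part» clause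
of S2′ up to the S1 identification of the constituents.  The file moves no book (HC_CM is proved only modulo the 7 printed citations until
rung 0 closes).

## References
* [Lam2001FirstCourse] T. Y. Lam, *A First Course in Noncommutative Rings*, 2nd ed. (2001), §3 (structure of semisimple rings;
  central idempotents and isotypic components).
* [BourbakiAlgebreVIII2012] N. Bourbaki, *Algèbre*, Ch. VIII (2012), §3 no. 2 (lemme de Schur), §4 no. 4 and no. 6 (modules et composants
  isotypiques), §5 no. 1 (commutant et bicommutant).
-/

set_option autoImplicit false

universe u v

namespace Literature.RingTheory.SimpleModule

variable {R : Type u} [Ring R] {M : Type v} [AddCommGroup M] [Module R M]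

/-! ## §1 Multiplication by a central element as an `R`-linear endomorphism -/

/-- Multiplication by a CENTRAL element `e` of `R` is an `R`-linear endomorphism of every `R`-module (the structure map
`DistribMulAction.toLinearMap` is only `ℤ`-linear for non-central `e`); stated as the existence of an `R`-linear map acting as `e • ·`,
to stay definition-free. [cite: BourbakiAlgebreVIII2012, §5 no. 1 (central idempotents act by endomorphisms)] -/
theorem exists_linearMap_apply_eq_smul {e : R} (hc : ∀ r : R, r * e = e * r) :
    ∃ f : M →ₗ[R] M, ∀ x : M, f x = e • x :=
  ⟨{ toFun := fun x => e • x
     map_add' := fun x y => smul_add e x y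
     map_smul' := fun r x => by rw [RingHom.id_apply, smul_smul, smul_smul, hc r] }, fun _ => rfl⟩

/-! ## §2 Simple submodules: a central idempotent acts as `1` or as `0` -/

/-- **On a SIMPLE submodule a central idempotent acts as `1` or as `0`** (Schur: the `R`-linear endomorphism `x ↦ e • x` of the simple
module `m` is `0` or bijective — Mathlib `LinearMap.bijective_or_eq_zero` — and a bijective idempotent is the identity).
[cite: Lam2001FirstCourse, §3 (Schur's lemma and its consequences)] [cite: BourbakiAlgebreVIII2012, §3 no. 2 (Lemme de Schur) and §5 no. 1] -/
theorem smul_eq_self_or_eq_zero_of_isSimpleModule {e : R} (he : IsIdempotentElem e) (hc : ∀ r : R, r * e = e * r)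
    (m : Submodule R M) [IsSimpleModule R m] :
    (∀ x ∈ m, e • x = x) ∨ (∀ x ∈ m, e • x = 0) := by
  obtain ⟨f, hf⟩ := exists_linearMap_apply_eq_smul (M := m) hc
  rcases LinearMap.bijective_or_eq_zero f with hbij | hzero
  · refine Or.inl fun x hx => ?_
    -- `f (f y) = f y` and `f` injective give `f y = y`
    have hy : f (f ⟨x, hx⟩) = f ⟨x, hx⟩ := by
      rw [hf, hf, smul_smul, he.eq]
    have := congrArg Subtype.val (hbij.1 hy)
    simpa only [hf, Submodule.coe_smul_of_tower, SetLike.val_smul] using this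
  · refine Or.inr fun x hx => ?_
    have := congrArg Subtype.val (show f ⟨x, hx⟩ = 0 by rw [hzero]; rfl)
    simpa only [hf, SetLike.val_smul, Submodule.coe_zero] using this

/-- The alternative is transported along `R`-linear isomorphisms of submodules: if `e` acts as `1` (resp. `0`) on `m` and `m ≃ₗ[R] m′`,
it acts as `1` (resp. `0`) on `m′`. [cite: BourbakiAlgebreVIII2012, §4 no. 4 (modules isotypiques)] -/
theorem smul_eq_iff_of_linearEquiv {e : R} {m m' : Submodule R M} (φ : m ≃ₗ[R] m') (c : R) (hc0 : c = 1 ∨ c = 0)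
    (h : ∀ x ∈ m, e • x = c • x) : ∀ x ∈ m', e • x = c • x := by
  intro x hx
  obtain ⟨y, hy⟩ := φ.surjective ⟨x, hx⟩
  have h1 : e • (φ y : M) = ((φ (e • y) : m') : M) := by rw [map_smul]; rfl
  have h2 : (e • y : m) = c • y := Subtype.ext (by simpa only [SetLike.val_smul] using h y.1 y.2)
  have hx' : (φ y : M) = x := congrArg Subtype.val hy
  rw [← hx', h1, h2, map_smul]
  rcases hc0 with rfl | rfl <;> simp

/-! ## §3 Isotypic components: a central idempotent acts as `1` or as `0` -/

/-- **On an isotypic component a central idempotent acts as `1` or as `0`**: the component `c = isotypicComponent R M S = Σ_{m ≅ S} m`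
is the supremum of the submodules isomorphic to the simple `S`; on `S` the idempotent acts as `1` or `0` (§2), the same holds on every
`m ≅ S` (transport), and the locus `{x | e • x = x}` (resp. `{x | e • x = 0}`) is a submodule (`LinearMap.eqLocus` / `ker` of the
`R`-linear `e_M`), so it contains the supremum. [cite: Lam2001FirstCourse, §3 (isotypic components and central idempotents)]
[cite: BourbakiAlgebreVIII2012, §4 no. 6 (composants isotypiques) and §5 no. 1] -/
theorem smul_eq_self_or_eq_zero_isotypicComponent {e : R} (he : IsIdempotentElem e) (hc : ∀ r : R, r * e = e * r)
    (S : Submodule R M) [IsSimpleModule R S] :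
    (∀ x ∈ isotypicComponent R M S, e • x = x) ∨ (∀ x ∈ isotypicComponent R M S, e • x = 0) := by
  obtain ⟨f, hf⟩ := exists_linearMap_apply_eq_smul (M := M) hc
  rcases smul_eq_self_or_eq_zero_of_isSimpleModule (M := M) he hc S with h1 | h0
  · -- the locus `{x | e • x = x}` is the submodule `eqLocus f id`, which contains every `m ≅ S`
    refine Or.inl fun x hx => ?_
    have hle : isotypicComponent R M S ≤ LinearMap.eqLocus f LinearMap.id := by
      refine sSup_le fun m hm => ?_
      obtain ⟨φ⟩ := hm
      intro y hy
      rw [LinearMap.mem_eqLocus, hf, LinearMap.id_apply]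
      simpa only [one_smul] using
        smul_eq_iff_of_linearEquiv φ.symm 1 (Or.inl rfl) (fun z hz => by rw [one_smul]; exact h1 z hz) y hy
    have := hle hx
    rwa [LinearMap.mem_eqLocus, hf, LinearMap.id_apply] at this
  · -- the locus `{x | e • x = 0}` is the submodule `ker f`
    refine Or.inr fun x hx => ?_
    have hle : isotypicComponent R M S ≤ LinearMap.ker f := by
      refine sSup_le fun m hm => ?_
      obtain ⟨φ⟩ := hm
      intro y hy
      rw [LinearMap.mem_ker, hf]
      simpa only [zero_smul] using
        smul_eq_iff_of_linearEquiv φ.symm 0 (Or.inr rfl) (fun z hz => by rw [zero_smul]; exact h0 z hz) y hy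
    have := hle hx
    rwa [LinearMap.mem_ker, hf] at this

/-- The same, indexed by the SET of isotypic components (`isotypicComponents R M`). [cite: Lam2001FirstCourse, §3] [cite: BourbakiAlgebreVIII2012, §4 no. 6 (composants isotypiques) and §5 no. 1] -/
theorem smul_eq_self_or_eq_zero_of_mem_isotypicComponents {e : R} (he : IsIdempotentElem e) (hc : ∀ r : R, r * e = e * r)
    {c : Submodule R M} (hcomp : c ∈ isotypicComponents R M) :
    (∀ x ∈ c, e • x = x) ∨ (∀ x ∈ c, e • x = 0) := by
  obtain ⟨S, hS, rfl⟩ := hcomp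
  haveI := hS
  exact smul_eq_self_or_eq_zero_isotypicComponent he hc S

end Literature.RingTheory.SimpleModule
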